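import Summits.ValiantsHypothesis.ValiantsHypothesis.Theorems.LacunarySymmetroidMatrixDescartesPivotTwoThree

/-!
# `MatrixDescartes` (stmt-ValiantsHypothesis-18050) — the `(m, K) = (2, 4)` pivot row has `Z₊ ≥ 8 = 2K`:
# a kernel witness with FOUR PSD letters and eight positive roots (`¬ PivotRootLawAt 2 4 1 7`)

HONEST FRAMING.  Cell `pub-symmetroid`, seat `val-sym-mdr-p1` (gen 5); helper `--supports` the crux
`Theses.LacunarySymmetroid.MatrixDescartes` (OPEN, on HOLD), NO closure claim.  Calibration of conjb-1's pivot column at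
`m = 2`: the tree has R1₂ `PivotRootLawAt 2 K q (2K + 2)` (upper), the located floor `2K − 3` (`RankOneStaircase`, K ≥ 4),
and — this seat — the sharp `(2, 3)` row `PivotRootLawAt 2 3 q 6` (`…PivotTwoThree`).  This file certifies a `2 × 2` pivot
pencil of negative index ONE with FOUR positive semidefinite letters and at least EIGHT distinct positive determinant zeros:
**`eight_le_card_posRoots_F₈`**, **`not_pivotRootLawAt_two_four_one_seven : ¬ PivotRootLawAt 2 4 1 7`** — so the `(2, 4)`
pivot constant at index one lies in `{8, 9, 10}`, the located floor `2K − 3 = 5` was not sharp, and `2K` is attained for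
`K = 1, 2, 3, 4` (seat conjecture, NOT asserted: the `m = 2` pivot constant is `2K`).  Nothing here bears on `MatrixDescartes`
in its window, `DoorA26`/`DoorA34`, the cell's registers, or `VP ≠ VNP`.

THE WITNESS (found by zero forcing in log-parameters at the integer exponents `(5, 7 | 8 | 9, 15)`, integerised at scale
`2^26`; seat memo WLAW-N2-SIX.md §5): `F(X) = X^8 • J + X^5 • P₅ + X^7 • P₇ + X^9 • P₉ + X^15 • P₁₅` with
`J = [[0, 2^26], [2^26, 0]]` (indefinite, index one: `J + W Wᵀ = 2^26 • 1` for `W = (8192, −8192)ᵀ`),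
`P₅ = [[120151, 414853], [414853, 2174959]]`, `P₇ = [[455869, 3248437], [3248437, 49973288]]`, `P₉ = [[99030293, 1596352], [1596352, 422497]]`,
`P₁₅ = [[46121, 14299], [14299, 4481]]` (integer, positive semidefinite).  `det F(t)` takes the signs `+,−,+,−,+,−,+,−,+` at the
nine rational points `93/256, 1721/4096, 1083/2048, 1699/2048, 293/256, 1463/1024, 879/512, 1915/1024, 1133/512`, so by the tree lemma
`le_card_posRoots_of_alternating` it has at least eight distinct positive roots (all in `(0.36, 2.22)`).

[folklore] Elementary; the sign pattern is a `norm_num` certificate at rational points.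
-/

-- `Summit.ValiantsHypothesis.ValiantsHypothesis.…` repeats a component by the D-0017 layout
-- (single-conjunct summit), which the `dupNamespace` linter flags; the name is mandated.
set_option linter.dupNamespace false

namespace Summit.ValiantsHypothesis.ValiantsHypothesis.Theorems.LacunarySymmetroidMatrixDescartes

open Summit.ValiantsHypothesis.ValiantsHypothesis.Theorems.SymmetroidDescartes (le_card_posRoots_of_alternating)
open scoped BigOperators Matrix
open Polynomial

/-- the indefinite pivot letter `J = 2^26 · antidiag(1, 1)` (exponent `e = 8`) -/
local notation3 (prettyPrint := false) "J₈" => (!![0, 67108864; 67108864, 0] : Matrix (Fin 2) (Fin 2) ℝ)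

/-- the four PSD letters at exponents `5, 7, 9, 15` -/
local notation3 (prettyPrint := false) "P₈" =>
  (![(!![120151, 414853; 414853, 2174959] : Matrix (Fin 2) (Fin 2) ℝ), (!![455869, 3248437; 3248437, 49973288] : Matrix (Fin 2) (Fin 2) ℝ),
     (!![99030293, 1596352; 1596352, 422497] : Matrix (Fin 2) (Fin 2) ℝ), (!![46121, 14299; 14299, 4481] : Matrix (Fin 2) (Fin 2) ℝ)] : Fin 4 → Matrix (Fin 2) (Fin 2) ℝ)

/-- the exponents `(5, 7, 9, 15)` of the PSD letters -/
local notation3 (prettyPrint := false) "d₈" => (![5, 7, 9, 15] : Fin 4 → ℕ)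

/-- the witness pencil `F = X^8 • J + ∑ₖ X^{dₖ} • Pₖ`, in the currency of `Pivot.pivotPosRoots` -/
local notation3 (prettyPrint := false) "F₈" =>
  (((X : ℝ[X]) ^ 8) • (J₈).map Polynomial.C + ∑ k, ((X : ℝ[X]) ^ (d₈ k)) • ((P₈ k).map Polynomial.C))

/-- nine positive rational test points -/
local notation3 (prettyPrint := false) "τ₈" => (![93/256, 1721/4096, 1083/2048, 1699/2048, 293/256, 1463/1024, 879/512, 1915/1024, 1133/512] : Fin 9 → ℝ)

namespace PivotTwoFourWitness

/-- A real symmetric `2 × 2` matrix with non-negative diagonal and non-negative determinant is positive semidefinite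
(`a(ax² + 2bxy + cy²) = (ax + by)² + (ac − b²)y²`). [folklore] -/
theorem posSemidef_two_of_entries (a b c : ℝ) (ha : 0 ≤ a) (hc : 0 ≤ c) (h : b * b ≤ a * c) :
    ((!![a, b; b, c] : Matrix (Fin 2) (Fin 2) ℝ)).PosSemidef := by
  refine Matrix.PosSemidef.of_dotProduct_mulVec_nonneg ?_ fun x => ?_
  · exact Matrix.IsHermitian.ext fun i j => by fin_cases i <;> fin_cases j <;> simp
  · simp only [Matrix.mulVec, dotProduct, Fin.sum_univ_two, Matrix.of_apply, Matrix.cons_val',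
      Matrix.cons_val_zero, Matrix.cons_val_one, Matrix.empty_val', Matrix.cons_val_fin_one, Pi.star_apply,
      star_trivial]
    rcases ha.eq_or_lt with ha0 | ha0
    · have hb : b = 0 := by
        rw [← ha0, zero_mul] at h
        nlinarith [mul_self_nonneg b]
      rw [← ha0, hb]
      nlinarith [mul_nonneg hc (mul_self_nonneg (x 1))]
    · have key : a * (x 0 * (a * x 0 + b * x 1) + x 1 * (b * x 0 + c * x 1))
          = (a * x 0 + b * x 1) ^ 2 + (a * c - b * b) * (x 1 * x 1) := by ring
      have hnn : a * 0 ≤ a * (x 0 * (a * x 0 + b * x 1) + x 1 * (b * x 0 + c * x 1)) := by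
        rw [key, mul_zero]
        nlinarith [sq_nonneg (a * x 0 + b * x 1), mul_nonneg (sub_nonneg.2 h) (mul_self_nonneg (x 1))]
      exact le_of_mul_le_mul_left hnn ha0

/-- the four letters are positive semidefinite -/
theorem P₈_posSemidef (k : Fin 4) : (P₈ k).PosSemidef := by
  fin_cases k
  · simpa using posSemidef_two_of_entries 120151 414853 2174959 (by norm_num) (by norm_num) (by norm_num)
  · simpa using posSemidef_two_of_entries 455869 3248437 49973288 (by norm_num) (by norm_num) (by norm_num)
  · simpa using posSemidef_two_of_entries 99030293 1596352 422497 (by norm_num) (by norm_num) (by norm_num)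
  · simpa using posSemidef_two_of_entries 46121 14299 4481 (by norm_num) (by norm_num) (by norm_num)

/-- `J` is symmetric -/
theorem J₈_isSymm : (J₈).IsSymm := Matrix.IsSymm.ext fun i j => by fin_cases i <;> fin_cases j <;> simp

/-- `J` has negative index one: `J + W Wᵀ = 2^26 · 1 ⪰ 0` for `W = (8192, −8192)ᵀ`. -/
theorem J₈_index_one : ∃ W : Matrix (Fin 2) (Fin 1) ℝ, (J₈ + W * Wᵀ).PosSemidef := by
  refine ⟨(!![8192; -8192] : Matrix (Fin 2) (Fin 1) ℝ), ?_⟩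
  have hdiag : (J₈ + (!![8192; -8192] : Matrix (Fin 2) (Fin 1) ℝ) * (!![8192; -8192] : Matrix (Fin 2) (Fin 1) ℝ)ᵀ)
      = Matrix.diagonal ![(67108864 : ℝ), 67108864] := by
    ext i j
    fin_cases i <;> fin_cases j <;>
      norm_num [Matrix.mul_apply, Matrix.diagonal, Matrix.transpose_apply, Matrix.vecHead, Matrix.vecTail]
  rw [hdiag, Matrix.posSemidef_diagonal_iff]
  intro i
  fin_cases i <;> norm_num

/-- `det F(t)` in closed form -/
theorem eval_det_F₈ (t : ℝ) :
    (Matrix.det F₈).eval t =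
      (120151 * t ^ 5 + 455869 * t ^ 7 + 99030293 * t ^ 9 + 46121 * t ^ 15)
          * (2174959 * t ^ 5 + 49973288 * t ^ 7 + 422497 * t ^ 9 + 4481 * t ^ 15)
        - (67108864 * t ^ 8 + 414853 * t ^ 5 + 3248437 * t ^ 7 + 1596352 * t ^ 9 + 14299 * t ^ 15) ^ 2 := by
  rw [StubReverse.eval_det_pencil]
  simp [Matrix.det_fin_two, Fin.sum_univ_four]
  ring

/-- the test points increase -/
theorem τ₈_strictMono : StrictMono τ₈ := by
  refine Fin.strictMono_iff_lt_succ.2 fun j => ?_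
  fin_cases j <;> simp <;> norm_num

/-- the test points are positive -/
theorem τ₈_pos (j : Fin 9) : 0 < τ₈ j := by
  fin_cases j <;> simp

/-- `det F` alternates in sign along the test points (signs `+,−,+,−,+,−,+,−,+`; `norm_num` certificate) -/
theorem alt₈ (j : Fin 8) :
    (Matrix.det F₈).eval (τ₈ j.castSucc) * (Matrix.det F₈).eval (τ₈ j.succ) < 0 := by
  fin_cases j <;> simp only [eval_det_F₈] <;> simp <;> norm_num

/-- **`Z₊ ≥ 8`** for the four-letter `2 × 2` pivot witness. -/
theorem eight_le_card_posRoots_F₈ :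
    8 ≤ ((Matrix.det F₈).roots.toFinset.filter (fun t => 0 < t)).card :=
  le_card_posRoots_of_alternating _ 8 τ₈ τ₈_strictMono τ₈_pos alt₈

end PivotTwoFourWitness

open PivotTwoFourWitness in
/-- **The `(2, 4)` pivot row is NOT `≤ 7`: `¬ PivotRootLawAt 2 4 1 7`** — a `2 × 2` pivot pencil of index one with four
PSD letters (exponents `5, 7 | 8 | 9, 15`) and eight distinct positive determinant zeros (`2K = 8` attained at `K = 4`;
with R1₂ the `(2, 4)` constant at index one lies in `{8, 9, 10}`). [folklore] -/
theorem not_pivotRootLawAt_two_four_one_seven : ¬ Pivot.PivotRootLawAt 2 4 1 7 := by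
  intro h
  have h7 := h 8 d₈ J₈ P₈ J₈_isSymm P₈_posSemidef J₈_index_one
  unfold Pivot.pivotPosRoots at h7
  exact absurd (eight_le_card_posRoots_F₈.trans h7) (by norm_num)

/-- Hence `PivotRootLawAt 2 4 1 B` fails for every `B ≤ 7` (the located floor `2K − 3 = 5` of the pivot column was
not sharp at `K = 4`). [folklore] -/
theorem not_pivotRootLawAt_two_four_one_of_le_seven {B : ℕ} (hB : B ≤ 7) : ¬ Pivot.PivotRootLawAt 2 4 1 B :=
  fun h => not_pivotRootLawAt_two_four_one_seven (Pivot.pivotRootLawAt_mono h hB)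

end Summit.ValiantsHypothesis.ValiantsHypothesis.Theorems.LacunarySymmetroidMatrixDescartes
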